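import Literature.NumberTheory.Transcendental.LinEDSGroups
import HarnessLib

/-!
# The linearised extended double shuffle system mod 2: block certificates with COMPACTED slots

Second extension of the kernel-checkable rank engine `LinEDS` (sibling files `LinEDS.lean` §9,
`LinEDSGroups.lean` §10). The packed Gauss elimination of a block of `n` columns in weight `k`
works on slots of width `W = 2^(k-1)` bits (the bit of a word is its code), and its cost — a few
matrix-sized GMP operations per column step — grows like `n² · W`; in weight 16 the largest depth
block (depth 8, `3431` columns) at `W = 2^15` exceeds one elaboration slot. But a block's rows are
supported on the block's `n` column codes only, so the slot can be COMPACTED: fold the bitset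
`r` into width `W'` by XOR-ing its `W'`-bit chunks (`xorFold`), which sends bit `c` to bit
`c % W'`; whenever `c ↦ c % W'` is injective on the block's columns (checked by `incMod` on the
column list supplied in increasing-residue order), the folded rows are the same `𝔽₂`-matrix with
its columns relabelled, and the elimination runs at width `W'` (`12287` instead of `32768` for
every weight-16 block). `checkBlockGC` = `checkBlockG` (grouped rows) with this compaction; the
soundness (bit `c % W'` of the fold = bit `c` of the row under injectivity) is proved in the
Summit-side soundness files, exactly as for §9–§10.

References: K. Ihara, M. Kaneko, D. Zagier, Compos. Math. 142 (2006) 307–338, §2, Conjecture 1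
[IharaKanekoZagier2006]; M. Kaneko, M. Noro, K. Tsurumaki, IMA Vol. Math. Appl. 148 (2008) 47–58.
-/

namespace Literature.NumberTheory.Transcendental

namespace LinEDS

/-! ### §11 Compacted slots -/

/-- **XOR-fold of a bitset into width `W'`**: while the number has a bit at or above `W'`, XOR
its part above bit `W'` (shifted down) into its low `W'` bits (`f` = fuel; with `r < 2^(W'(f+1))`
the fold is complete). Bit `j < W'` of the result is the XOR of the bits `j, j + W', j + 2W', …`
of `r`. [folklore] -/
def xorFold (W' : ℕ) : ℕ → ℕ → ℕ
  | 0, r => r % 2 ^ W'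
  | f + 1, r => bif Nat.blt r (2 ^ W') then r else xorFold W' f ((r >>> W') ^^^ (r % 2 ^ W'))

/-- The residues mod `W'` are strictly increasing along the list (so `c ↦ c % W'` is injective on
it and the relabelled columns come in elimination order). [folklore] -/
def incMod (W' : ℕ) : List ℕ → Bool
  | a :: b :: l => Nat.blt (a % W') (b % W') && incMod W' (b :: l)
  | _ => true

/-- **One block of a grouped, compacted block certificate**: columns of depth in `(lo, D]`,
listed by the certificate as `L` (every entry a block column, residues mod `W'` strictly
increasing, as many entries as block columns, `W'` larger than their number); exactly as many
groups as block columns, every member name valid; no group row has a bit at a column of depth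
`> D`; and the group rows masked to the block and XOR-folded into width `W'`, packed in the listed
(pivot) order, eliminate fully along the relabelled columns `L.map (· % W')`.
[cite: IharaKanekoZagier2006, Conjecture 1] -/
def checkBlockGC (k lo D W' f : ℕ) (L : List ℕ) (groups : List (List (List ℕ × List ℕ))) : Bool :=
  let C := colsDepth k lo D
  let mask := maskOf C
  let higher := maskOf (colsDepth k D k)
  let rows := groups.map (rowBitsG k)
  sameLength groups C && sameLength L C && L.all (fun c => mask.testBit c) && incMod W' L &&
    Nat.blt (lengthTR C) W' &&
    groups.all (fun g => g.all (validName k)) && rows.all (fun r => r &&& higher == 0) &&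
    elimLoop W' (rep W' (lengthTR groups)) (L.map (· % W'))
      (pack W' (rows.map fun r => xorFold W' f (r &&& mask)))

/-- **One grouped, compacted block, encoded names** (each group a list of numerals,
`decodeName`). [cite: IharaKanekoZagier2006, Conjecture 1] -/
def checkBlockGCEnc (k lo D W' f : ℕ) (L : List ℕ) (codes : List (List ℕ)) : Bool :=
  checkBlockGC k lo D W' f L (codes.map fun g => g.map decodeName)

/-- The fold lands below `2^W'`. [folklore] -/
theorem xorFold_lt {W' : ℕ} : ∀ f r : ℕ, xorFold W' f r < 2 ^ W'
  | 0, r => Nat.mod_lt _ (by positivity)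
  | f + 1, r => by
    rw [xorFold]
    cases h : Nat.blt r (2 ^ W')
    · exact xorFold_lt f _
    · simpa [Nat.blt_eq] using h

/-- `incMod` says the residues form a `<`-chain. [folklore] -/
theorem incMod_eq_true_iff {W' : ℕ} :
    ∀ L : List ℕ, incMod W' L = true ↔ (L.map (· % W')).IsChain (· < ·)
  | [] => by simp [incMod]
  | [a] => by simp [incMod]
  | a :: b :: l => by
    rw [incMod, Bool.and_eq_true, incMod_eq_true_iff (b :: l)]
    simp [Nat.blt_eq]

/-- Sanity (kernel): in weight `5` the six columns `1, 3, 7, 11, 13, 15` have distinct residues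
mod `W' = 9`; listed in residue order `1, 11, 3, 13, 15, 7` (residues `1, 2, 3, 4, 6, 7`) they are
certified at slot width `9` by six singleton groups; the same, encoded; and two values of
`xorFold`. [folklore] -/
theorem checkBlockGC_sanity :
    checkBlockGC 5 0 4 9 1 [1, 11, 3, 13, 15, 7] [[([2], [3])], [([2], [2, 1])], [([4], [1])],
      [([2], [1, 2])], [([2, 1, 1], [1])], [([3, 1], [1])]] = true ∧
    checkBlockGCEnc 5 0 4 9 1 [1, 11, 3, 13, 15, 7] [[5 * 2 ^ 16 + 9], [5 * 2 ^ 16 + 11],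
      [17 * 2 ^ 16 + 3], [5 * 2 ^ 16 + 13], [23 * 2 ^ 16 + 3], [19 * 2 ^ 16 + 3]] = true ∧
    xorFold 9 1 (2 ^ 11 + 2 ^ 3) = 2 ^ 2 + 2 ^ 3 ∧ xorFold 4 3 (2 ^ 13 + 2 ^ 6 + 1) = 2 ^ 1 + 2 ^ 2 + 1 := by
  refine ⟨?_, ?_, ?_, ?_⟩ <;> decide +kernel

end LinEDS

end Literature.NumberTheory.Transcendental
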